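import Summits.Schanuel.Schanuel.Theorems.RootDecomp1KTwoBaseCell08
import Literature.Algebra.Polynomial.JacobianCriterion

/-!
# RootDecomp1KCommonRadixCell — lens 1, generation 37 «COMMON-RADIX WALL CELL of 33364» (the dependent-base wall `(1, ℓ₂, ℓ₄)`) — part 1 (RootDecomp1KCommonRadixCell01): §1 tails of Liouville numbers and the k-step tail split, §2 the mixed-radix scales `E_j`, `kappa`, §3 power sums with distinct exponents are algebraically independent (generalised Vandermonde Jacobian, tree criterion by name)

PORT NOTE (census-1 gen 16, 2026-08-31): port of HOME/decomp-schanuel-lens-1/g37/RootDecomp1KCommonRadixCell.lean (sha256 2ee3a3e8…2418,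
2500 l; own farm rc 0 · 0 warn · 0 sorry · axioms std; critic VERDICT STATUS L1748: CHECKLIST K-g37 MET, ONE cell-decision credit to lens-1 g37
under K-R23 (β′); PORT GO LOW `--supports stmt-Schanuel-33364` AFTER the TwoBaseCell port, g36 local copies → imports of the TwoBaseCell parts).
Seven parts `RootDecomp1KCommonRadixCell01`–`07`: 01 = §1 tails + §2 mixed-radix scales + §3 power sums / Jacobian (tree
`Literature.Algebra.Polynomial.JacobianCriterion` BY NAME), 02 = §4 (CR-dom) `eventually_eval_partialSum_ne_zero_commonRadix`, 03 = §5 tools +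
extraction engine, 04 = §5 `TruncGeneric` equivalence + §6 suppliers (e-cells keep `(hNW : NWMeasure)`), 05 = §7 hypothesis-free certificates
and the two-scale form bound, 06 = §8 cells against the LIVE binders (item text verbatim + one range line; NO Theses import) and the members
`z_V`, `z_V^π`, 07 = §8 separation + §9 CHECKLIST names. PORT EDITS: the 22 «(g36, verbatim)» copies that are PUBLIC in the landed
`RootDecomp1KTwoBaseCell01`–`08` (partialSum_pos', liouvilleNumber_le, partialSum_lt_two, numerator_lt, exists_int_mul_eq_map',
algebraicIndependent_of_forall_int', norm_pow_sub_pow_le', norm_prod_pow_sub_prod_pow_le, norm_aeval_sub_aeval_le, growth_beats, lpart, tpart,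
lpart_apply, tpart_apply, eq_of_parts_eq, psNumer, partialSum_eq_psNumer_div, coprime_psNumer, liouvilleNumber_sub_rat_lower_loglog,
not_logLogLiouville_liouvilleNumber, liouvilleNumber_three_lt_one, sb_of_range_eq') are DELETED and opened from the tree (`import
…RootDecomp1KTwoBaseCell08` replaces `…RootDecomp1KLogLogCell01`, which it imports); the ten copies whose tree twins are PRIVATE are private
here (per-part private copies); `set_option linter.dupNamespace false` dropped; 24 one-line docstrings added; statements and proofs otherwise
verbatim. Nothing here proves Schanuel; rung 0. The lens's header follows.
-/

/-!
# RootDecomp1K — lens 1 (grading / quantitative ladder), gen 37: the «COMMON-RADIX WALL CELL» of item 33364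
# (`FiniteOrderLiouvilleSchanuel`, A₄ᵈ) — Schanuel's bound on the DEPENDENT-BASE wall `(1, ℓ₂, ℓ₄)` (mod the
# by-name fact `NWMeasure`) and on its π-twin `(π, πℓ₂, πℓ₄)` HYPOTHESIS-FREE; more generally on every
# COMMON-RADIX cell `(1, ℓ_{β^{a_1}}, …, ℓ_{β^{a_k}})` (`β ≥ 2`, `a` injective, `a_i ≥ 1`), `ℓ_b = liouvilleNumber b`,
# and — the conceptual form — on every LIOUVILLE-BLOCK cell `(1, ℓ_{b_1}, …, ℓ_{b_k})` whose block is algebraically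
# independent (the JOIN THEOREM (X″): a measured `θ⃗` is algebraically independent from any algebraically independent
# block of standard Liouville numbers).

HEADER: see `NODE-g37.md` next to this file (cell decomp-schanuel, seat `decomp-schanuel-lens-1`, gen 37, 2026-08-31;
RULE K-R23 (β′), STATUS L1729; claim L1734).  Route of record `route-Schanuel-RootDecomp1K` (DRAFT; `closes hL hH hF
hB`), item **F** = `Summit.Schanuel.Schanuel.Theses.RootDecomp1K.FiniteOrderLiouvilleSchanuel` (stmt-Schanuel-33364).
Nothing here proves Schanuel; rung 0.  No 1K decl is restated: the item is consumed BY NAME in the probe file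
(`CRprobe.lean`).  Imports tree Theorems only (`…RootDecomp1KLogLogCell01` = g35 ported) and the tree Literature
file `Literature.Algebra.Polynomial.JacobianCriterion` (Humphreys § 3.10); the e-versions carry the tree's by-name
fact binder `(hNW : NWMeasure)` exactly as g34–g36 / Hyper01 prescribe; π-versions nothing.  Lemmas marked
«(g36, verbatim)» are copied from this seat's gen-36 kernel `RootDecomp1KTwoBaseCell.lean` (sha256 f6aad3c3…,
NODE-g36.md), whose writer port `…Theorems.RootDecomp1KTwoBaseCell01, 02, …` began landing WHILE this file was
built (07:31Z–); this file deliberately does NOT import the in-progress port (different namespace, no name clash),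
so it checks against the TREE at any stage of that port.  Sections: §1 tails · §2 mixed-radix scales · §3 power sums
/ Jacobian · §4 (CR-dom) · §5 extraction engine, `TruncGeneric`, (X″), (CR) · §6 suppliers · §7 certificates
(`¬ LogLogLiouville ℓ_b`, `b ↦ ℓ_b` injective, two-scale form bound for `(1, ℓ₂, ℓ₄)`) · §8 cells vs the LIVE
binders, members `z_V`, `z_V^π`, separation · §9 CHECKLIST K-g37 names and control-side facts.
-/

noncomputable section

open Complex IntermediateField Polynomial
open Summit.Schanuel.Schanuel.Theorems.RootDecomp1KHyper
open Summit.Schanuel.Schanuel.Theorems.RootDecomp1KHyper.HyperCell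
open Summit.Schanuel.Schanuel.Theorems.RootDecomp1KGeneric
open Summit.Schanuel.Schanuel.Theorems.RootDecomp1KRelLiouvilleCell
open Summit.Schanuel.Schanuel.Theorems.RootDecomp1KLogLogCell (LogLogLiouville logLogLiouville_of_logSqLiouville
  logLogLiouville_of_logHyperLiouville logLogLiouville_of_hyperLiouville)
open Summit.Schanuel.Schanuel.Theorems.RootDecomp1KTwoBaseCell (partialSum_pos' liouvilleNumber_le partialSum_lt_two numerator_lt exists_int_mul_eq_map' algebraicIndependent_of_forall_int' norm_pow_sub_pow_le' norm_prod_pow_sub_prod_pow_le norm_aeval_sub_aeval_le growth_beats lpart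
  tpart lpart_apply tpart_apply eq_of_parts_eq psNumer partialSum_eq_psNumer_div coprime_psNumer liouvilleNumber_sub_rat_lower_loglog not_logLogLiouville_liouvilleNumber liouvilleNumber_three_lt_one sb_of_range_eq')

namespace Summit.Schanuel.Schanuel.Theorems.RootDecomp1KCommonRadixCell

/-! ## §1  Tails of Liouville numbers in base `m ≥ 2` (g36 §1, verbatim) and the `k`-step tail split (new) -/

section Tails
open LiouvilleNumber
open scoped Nat

/-- The tail recursion `r_k = m^{-(k+1)!} + r_{k+1}` (g36, verbatim). -/
private theorem remainder_eq_succ {m : ℝ} (hm : 1 < m) (k : ℕ) :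
    remainder m k = 1 / m ^ (k + 1)! + remainder m (k + 1) := by
  have h1 := partialSum_add_remainder hm k
  have h2 := partialSum_add_remainder hm (k + 1)
  rw [partialSum_succ] at h2
  linarith

/-- Lower bound for the tail: its first term, `m^{-(k+1)!} ≤ r_k` (g36, verbatim). -/
private theorem remainder_ge {m : ℝ} (hm : 1 < m) (k : ℕ) : 1 / m ^ (k + 1)! ≤ remainder m k := by
  rw [remainder_eq_succ hm k]
  linarith [remainder_pos hm (k + 1)]

/-- Upper bound for the tail in base `m ≥ 2`: `r_k ≤ 2·m^{-(k+1)!}` (g36, verbatim). -/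
private theorem remainder_le {m : ℝ} (hm : 2 ≤ m) (k : ℕ) : remainder m k ≤ 2 / m ^ (k + 1)! := by
  have m1 : (1 : ℝ) < m := by linarith
  have m0 : (0 : ℝ) < m := by linarith
  have h := remainder_lt' k m1
  have hhalf : (1 : ℝ) / m ≤ 1 / 2 := one_div_le_one_div_of_le two_pos hm
  have hpos : (0 : ℝ) < 1 - 1 / m := by linarith
  have hinv : (1 - 1 / m)⁻¹ ≤ 2 := by
    rw [inv_le_comm₀ hpos two_pos]
    linarith
  have hmk : (0 : ℝ) < 1 / m ^ (k + 1)! := by positivity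
  calc remainder m k ≤ (1 - 1 / m)⁻¹ * (1 / m ^ (k + 1)!) := h.le
    _ ≤ 2 * (1 / m ^ (k + 1)!) := mul_le_mul_of_nonneg_right hinv hmk.le
    _ = 2 / m ^ (k + 1)! := by ring

/-- **The `k`-step tail split (new):** `r_N = Σ_{j<k} m^{-(N+1+j)!} + r_{N+k}`. -/
theorem remainder_split {m : ℝ} (hm : 1 < m) (N : ℕ) :
    ∀ k : ℕ, remainder m N = (∑ j ∈ Finset.range k, 1 / m ^ (N + 1 + j)!) + remainder m (N + k)
  | 0 => by simp
  | k + 1 => by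
    rw [remainder_split hm N k, Finset.sum_range_succ, remainder_eq_succ hm (N + k)]
    have e : N + k + 1 = N + 1 + k := by ring
    rw [e, ← add_assoc]
    ring

/-- The partial sums converge to the Liouville number. -/
theorem tendsto_partialSum {m : ℝ} (hm : 1 < m) :
    Filter.Tendsto (fun N => partialSum m N) Filter.atTop (nhds (liouvilleNumber m)) := by
  have h := (LiouvilleNumber.summable hm).hasSum.tendsto_sum_nat
  have e : (fun N => partialSum m N) = (fun n : ℕ => ∑ i ∈ Finset.range n, 1 / m ^ i !) ∘ fun N => N + 1 := by
    funext N; rfl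
  rw [e]
  exact h.comp (Filter.tendsto_add_atTop_nat 1)

end Tails

/-! ## §2  The scales of the common-radix expansion: `E_j = (N+2)(N+3)⋯(N+1+j)`, mixed-radix packing -/

section Scales
open scoped Nat

/-- The exponent of the `j`-th tail scale relative to `u = β^{-(N+1)!}`: `E N j = (N+2).ascFactorial j`, so that
`(N+1)! · E N j = (N+1+j)!`. -/
def E (N j : ℕ) : ℕ := (N + 2).ascFactorial j

/-- `E_0 = 1`. -/
theorem E_zero (N : ℕ) : E N 0 = 1 := Nat.ascFactorial_zero _

/-- Recursion `E_{j+1} = (N+2+j) · E_j`. -/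
theorem E_succ (N j : ℕ) : E N (j + 1) = (N + 2 + j) * E N j := Nat.ascFactorial_succ

/-- `E_j > 0`. -/
theorem E_pos (N j : ℕ) : 0 < E N j := Nat.ascFactorial_pos _ _

/-- `E_j ≥ 1`. -/
theorem one_le_E (N j : ℕ) : 1 ≤ E N j := E_pos N j

/-- `(N+1)! · E_j = (N+1+j)!`. -/
theorem factorial_mul_E (N j : ℕ) : (N + 1)! * E N j = (N + 1 + j)! :=
  Nat.factorial_mul_ascFactorial (N + 1) j

/-- `E` is monotone in `j`. -/
theorem E_le_E_succ (N j : ℕ) : E N j ≤ E N (j + 1) := by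
  rw [E_succ]; exact Nat.le_mul_of_pos_left _ (by omega)

/-- `j ↦ E_j` is monotone. -/
theorem E_mono (N : ℕ) {i j : ℕ} (hij : i ≤ j) : E N i ≤ E N j := by
  induction hij with
  | refl => exact le_rfl
  | step _ ih => exact ih.trans (E_le_E_succ N _)

/-- **Telescoping bound:** digits `≤ N+1` pack strictly below the next scale, `Σ_{j<k} d_j E_j < E_k`. -/
theorem sum_mul_E_lt (N : ℕ) {d : ℕ → ℕ} (hd : ∀ j, d j ≤ N + 1) :
    ∀ k : ℕ, ∑ j ∈ Finset.range k, d j * E N j < E N k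
  | 0 => by simp [E_zero]
  | k + 1 => by
    rw [Finset.sum_range_succ, E_succ]
    have ih := sum_mul_E_lt N hd k
    have h1 : d k * E N k ≤ (N + 1) * E N k := Nat.mul_le_mul_right _ (hd k)
    nlinarith [E_pos N k]

/-- The bottom factorisation of the ascending factorial: `n^{(j+1)} = n · (n+1)^{(j)}`. -/
theorem ascFactorial_succ_eq_mul (n j : ℕ) : n.ascFactorial (j + 1) = n * (n + 1).ascFactorial j := by
  rw [Nat.succ_ascFactorial n j]; exact Nat.ascFactorial_succ

/-- **Mixed-radix uniqueness:** digits `< n` in the scales `n.ascFactorial j` determine the number. -/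
theorem mixedRadix_injective :
    ∀ (k n : ℕ) (d d' : ℕ → ℕ), (∀ j, j < k → d j < n) → (∀ j, j < k → d' j < n) →
      ∑ j ∈ Finset.range k, d j * n.ascFactorial j = ∑ j ∈ Finset.range k, d' j * n.ascFactorial j →
      ∀ j, j < k → d j = d' j
  | 0 => fun _ _ _ _ _ _ j hj => absurd hj (Nat.not_lt_zero j)
  | k + 1 => by
    intro n d d' hd hd' hsum j hj
    have hn : 0 < n := by have := hd 0 (Nat.succ_pos k); omega
    have expand : ∀ f : ℕ → ℕ, ∑ j ∈ Finset.range (k + 1), f j * n.ascFactorial j =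
        f 0 + n * ∑ j ∈ Finset.range k, f (j + 1) * (n + 1).ascFactorial j := by
      intro f
      rw [Finset.sum_range_succ', Nat.ascFactorial_zero, mul_one, add_comm, Finset.mul_sum]
      congr 1
      refine Finset.sum_congr rfl fun j _ => ?_
      rw [ascFactorial_succ_eq_mul]; ring
    rw [expand d, expand d'] at hsum
    set X := ∑ j ∈ Finset.range k, d (j + 1) * (n + 1).ascFactorial j with hX
    set X' := ∑ j ∈ Finset.range k, d' (j + 1) * (n + 1).ascFactorial j with hX'
    have h0 : d 0 = d' 0 := by
      have e1 : (d 0 + n * X) % n = d 0 := by rw [Nat.add_mul_mod_self_left, Nat.mod_eq_of_lt (hd 0 (by omega))]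
      have e2 : (d' 0 + n * X') % n = d' 0 := by
        rw [Nat.add_mul_mod_self_left, Nat.mod_eq_of_lt (hd' 0 (by omega))]
      rw [← e1, ← e2, hsum]
    have hXX : X = X' := by
      have e1 : (d 0 + n * X) / n = X := by
        rw [Nat.add_mul_div_left _ _ hn, Nat.div_eq_of_lt (hd 0 (by omega)), zero_add]
      have e2 : (d' 0 + n * X') / n = X' := by
        rw [Nat.add_mul_div_left _ _ hn, Nat.div_eq_of_lt (hd' 0 (by omega)), zero_add]
      rw [← e1, ← e2, hsum]
    rcases j with _ | j
    · exact h0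
    · have hj' : j < k := by omega
      exact mixedRadix_injective k (n + 1) (fun j => d (j + 1)) (fun j => d' (j + 1))
        (fun i hi => by have := hd (i + 1) (by omega); omega)
        (fun i hi => by have := hd' (i + 1) (by omega); omega) (by rw [← hX, ← hX', hXX]) j hj'

variable {k : ℕ}

/-- Extension of an exponent vector on `Fin k` to `ℕ` by zero. -/
def ext0 (m : Fin k →₀ ℕ) (j : ℕ) : ℕ := if h : j < k then m ⟨j, h⟩ else 0

/-- `ext0 m` agrees with `m` on `Fin k`. -/
theorem ext0_apply_fin (m : Fin k →₀ ℕ) (j : Fin k) : ext0 m j = m j := by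
  simp [ext0, j.isLt]

/-- The packed exponent `κ(m) = Σ_j m_j E_j`. -/
def kappa (N : ℕ) (m : Fin k →₀ ℕ) : ℕ := ∑ j : Fin k, m j * E N j

/-- `kappa N m` as a sum over `range k`. -/
theorem kappa_eq_sum_range (N : ℕ) (m : Fin k →₀ ℕ) :
    kappa N m = ∑ j ∈ Finset.range k, ext0 m j * E N j := by
  rw [kappa, Finset.sum_range]
  exact Finset.sum_congr rfl fun j _ => by rw [ext0_apply_fin]

/-- **`κ` is injective on exponent vectors with entries `≤ N+1`.** -/
theorem kappa_injective (N : ℕ) {m m' : Fin k →₀ ℕ} (hm : ∀ j, m j ≤ N + 1) (hm' : ∀ j, m' j ≤ N + 1)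
    (h : kappa N m = kappa N m') : m = m' := by
  rw [kappa_eq_sum_range, kappa_eq_sum_range] at h
  have key := mixedRadix_injective k (N + 2) (ext0 m) (ext0 m')
    (fun j hj => by simp only [ext0, dif_pos hj]; have := hm ⟨j, hj⟩; omega)
    (fun j hj => by simp only [ext0, dif_pos hj]; have := hm' ⟨j, hj⟩; omega) h
  ext j
  have := key j j.isLt
  rwa [ext0_apply_fin, ext0_apply_fin] at this

/-- **`κ(m) < E_k`** for exponent vectors with entries `≤ N+1`. -/
theorem kappa_lt_E (N : ℕ) {m : Fin k →₀ ℕ} (hm : ∀ j, m j ≤ N + 1) : kappa N m < E N k := by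
  rw [kappa_eq_sum_range]
  refine sum_mul_E_lt N (fun j => ?_) k
  by_cases hj : j < k
  · simp only [ext0, dif_pos hj]; exact hm ⟨j, hj⟩
  · simp only [ext0, dif_neg hj]; exact Nat.zero_le _

end Scales

/-! ## §3  The universal polynomial: power sums with distinct exponents are algebraically independent (Jacobian) -/

section PowerSums
open MvPolynomial
open Literature.Algebra.Polynomial.JacobianCriterion (jacobianMatrix jacobianMatrix_apply
  algebraicIndependent_iff_det_jacobianMatrix_ne_zero)

variable {k : ℕ}

/-- The power-sum substitution `Φ_i(T) = Σ_j T_j^{a_i}`. -/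
def powerSum (a : Fin k → ℕ) (i : Fin k) : MvPolynomial (Fin k) ℝ :=
  ∑ j : Fin k, monomial (Finsupp.single j (a i)) 1

/-- Evaluating the power sum `Σ_j T_j^{a_i}`. -/
theorem eval_powerSum (a : Fin k → ℕ) (i : Fin k) (T : Fin k → ℝ) :
    MvPolynomial.eval T (powerSum a i) = ∑ j, T j ^ a i := by
  rw [powerSum, map_sum]
  refine Finset.sum_congr rfl fun j _ => ?_
  rw [MvPolynomial.eval_monomial, one_mul, Finsupp.prod_single_index]
  exact pow_zero _

/-- The Jacobian of the power sums: `∂Φ_i/∂T_j = a_i T_j^{a_i − 1}`. -/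
theorem jacobianMatrix_powerSum (a : Fin k → ℕ) (i j : Fin k) :
    jacobianMatrix (powerSum a) i j = monomial (Finsupp.single j (a i - 1)) (a i : ℝ) := by
  classical
  rw [jacobianMatrix_apply, powerSum, map_sum, Finset.sum_eq_single j]
  · rw [pderiv_monomial_single, one_mul]
  · intro j' _ hne
    have h0 : (Finsupp.single j' (a i)) j = 0 := by rw [Finsupp.single_apply, if_neg hne]
    rw [pderiv_monomial, h0, Nat.cast_zero, mul_zero, monomial_zero]
  · intro h; exact absurd (Finset.mem_univ j) h

/-- The exponent vector of the permutation term `σ` of the Jacobian determinant: `i ↦ a(σ i) − 1`. -/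
def expo (a : Fin k → ℕ) (σ : Equiv.Perm (Fin k)) : Fin k →₀ ℕ :=
  ∑ i : Fin k, Finsupp.single i (a (σ i) - 1)

/-- Components of the exponent vector `expo a σ`. -/
theorem expo_apply (a : Fin k → ℕ) (σ : Equiv.Perm (Fin k)) (i : Fin k) : expo a σ i = a (σ i) - 1 := by
  classical
  rw [expo, Finset.sum_apply']
  simp only [Finsupp.single_apply, Finset.sum_ite_eq', Finset.mem_univ, if_true]

/-- For injective `a ≥ 1`, the exponent vector of `σ` equals that of the identity iff `σ = 1`. -/
theorem expo_eq_one_iff {a : Fin k → ℕ} (ha : Function.Injective a) (ha1 : ∀ i, 1 ≤ a i)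
    (σ : Equiv.Perm (Fin k)) : expo a σ = expo a 1 ↔ σ = 1 := by
  constructor
  · intro h
    ext i
    have hi := congrArg (fun f => f i) h
    simp only [expo_apply, Equiv.Perm.coe_one, id_eq] at hi
    have h1 := ha1 (σ i)
    have h2 := ha1 i
    have : a (σ i) = a i := by omega
    exact congrArg Fin.val (ha this)
  · rintro rfl; rfl

/-- The Jacobian determinant of the power sums, as an explicit sum of monomials. -/
theorem det_jacobianMatrix_powerSum (a : Fin k → ℕ) :
    (jacobianMatrix (powerSum a)).det =
      ∑ σ : Equiv.Perm (Fin k), monomial (expo a σ) (((Equiv.Perm.sign σ : ℤ) : ℝ) * ∏ i, (a (σ i) : ℝ)) := by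
  rw [Matrix.det_apply']
  refine Finset.sum_congr rfl fun σ _ => ?_
  have e1 : ∏ i, jacobianMatrix (powerSum a) (σ i) i = monomial (expo a σ) (∏ i, (a (σ i) : ℝ)) := by
    simp only [jacobianMatrix_powerSum]
    rw [expo, monomial_sum_prod]
  rw [e1]
  have e2 : ((Equiv.Perm.sign σ : ℤ) : MvPolynomial (Fin k) ℝ) =
      MvPolynomial.C (((Equiv.Perm.sign σ : ℤ) : ℝ)) := by
    rw [← map_intCast (MvPolynomial.C : ℝ →+* MvPolynomial (Fin k) ℝ)]
  rw [e2, MvPolynomial.C_mul_monomial]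

/-- **`det J(Φ) ≠ 0`** for injective exponents `a_i ≥ 1`: the coefficient of the diagonal monomial
`∏ T_i^{a_i − 1}` is `∏ a_i` (only `σ = 1` contributes, by injectivity of `a`). -/
theorem det_jacobianMatrix_powerSum_ne_zero {a : Fin k → ℕ} (ha : Function.Injective a) (ha1 : ∀ i, 1 ≤ a i) :
    (jacobianMatrix (powerSum a)).det ≠ 0 := by
  classical
  intro h
  have hc := congrArg (MvPolynomial.coeff (expo a 1)) h
  rw [det_jacobianMatrix_powerSum, MvPolynomial.coeff_sum, MvPolynomial.coeff_zero,
    Finset.sum_eq_single (1 : Equiv.Perm (Fin k))] at hc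
  · rw [MvPolynomial.coeff_monomial, if_pos rfl, Equiv.Perm.sign_one] at hc
    simp only [Units.val_one, Int.cast_one, one_mul, Equiv.Perm.coe_one, id_eq] at hc
    exact (Finset.prod_ne_zero_iff.mpr fun i _ => (by have := ha1 i; positivity : (a i : ℝ) ≠ 0)) hc
  · intro σ _ hσ
    rw [MvPolynomial.coeff_monomial, if_neg]
    exact fun h' => hσ ((expo_eq_one_iff ha ha1 σ).mp h')
  · intro h1; exact absurd (Finset.mem_univ _) h1

/-- **The power sums with distinct positive exponents are algebraically independent over `ℝ`** (tree Jacobian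
criterion, `Literature.Algebra.Polynomial.JacobianCriterion`). -/
theorem algebraicIndependent_powerSum {a : Fin k → ℕ} (ha : Function.Injective a) (ha1 : ∀ i, 1 ≤ a i) :
    AlgebraicIndependent ℝ (powerSum a) :=
  (algebraicIndependent_iff_det_jacobianMatrix_ne_zero _).mpr (det_jacobianMatrix_powerSum_ne_zero ha ha1)

/-- Hence the substitution `p ↦ p(Φ_1(T), …, Φ_k(T))` kills no non-zero polynomial. -/
theorem bind₁_powerSum_ne_zero {a : Fin k → ℕ} (ha : Function.Injective a) (ha1 : ∀ i, 1 ≤ a i)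
    {p : MvPolynomial (Fin k) ℝ} (hp : p ≠ 0) : bind₁ (powerSum a) p ≠ 0 := by
  intro h
  have hinj := algebraicIndependent_powerSum ha ha1
  rw [AlgebraicIndependent, aeval_eq_bind₁] at hinj
  exact hp (hinj (by rw [h, map_zero]))

end PowerSums

end Summit.Schanuel.Schanuel.Theorems.RootDecomp1KCommonRadixCell

end
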